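import Mathlib
import HarnessLib
import Summits.HubbardSuperconductivity.HubbardSuperconductivity.Theorems.KLProgrammeKLRegimeEngineTowerMeasuredSubadditive

/-!
# Route `KLProgramme` — crux K3 ENGINE (stmt-HubbardSuperconductivity-20437 `KLRegimeEngineV17F2`), stub (b) v2, THE LEVELS PACKAGE (ℓ):
# (I6)/(I7) glue — conjunct 2's two clauses at a read-out level `j` from the tower's THREE-PART decomposition with suprema over pins
# (E1-LEVELS-BLUEPRINT-g8 (I6)–(I7); E1 lead r2d-p2 g8)

Part 13 (`kernelNormsWt4_klWtBudget_of_decomposition`, `kernelNormsLevels_of_decomposition`) reads the registered clauses off ANY decomposition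
`𝒱_j[K] = Σ_i T i` with per-summand bounds.  The tower's decomposition is fixed (`klEffectiveAction_eq_blocked`):
`𝒱_j = 𝒱_0 + Σ_{k < j/d} Δ_k + (𝒱_j − 𝒱_{d(j/d)})` (`Δ_k = klTowerIncr … d k`, `𝒱_{d(j/d)} = klTowerInput … d (j/d)`), and the natural per-summand bounds are
the SUPREMA over pins of the level-`j` currencies of …EngineTowerModelDefs.  This file states the two clauses in exactly that form, so that the closing files
(I6)/(I7) only have to FIT three kinds of numbers — re-measured UV, re-measured block increments, partial-block increment — under the budget:

* **`kernelNormsWt4_klWtBudget_of_towerSups`** — if, in every degree `m ≠ 2`,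
  `(⨆ pins, klWtPinnedSumOf … j m 𝒱_0) + Σ_{k<j/d} (⨆ pins, klWtPinnedSumOf … j m Δ_k) + (⨆ pins, klWtPinnedSumOf … j m (𝒱_j − 𝒱_{d(j/d)})) ≤ klWtBudget P Q U j m`,
  then `KernelNormsWt4 L M (klWtBudget P Q U j) β U μ K j`;
* **`kernelNormsLevels_of_towerSups`** — the levelled twin: the same three-part sum of suprema over prescriptions of level-count `F`, fitted under
  `Q.CE^p · ε_j^{p−1} · 2^{(3p−5)j} · (2^{−j})^{levelGainExp F}` for every `p ≥ 3` and `F`, gives `KernelNormsLevels L M P Q β U μ K j`.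
Pure bookkeeping; nothing about the model is asserted.
-/

noncomputable section

namespace Summit.HubbardSuperconductivity.HubbardSuperconductivity.Theorems.EngineV8

set_option linter.dupNamespace false -- summit = problem name (single-conjunct summit), D-0017

open Real Finset Literature.MathematicalPhysics.QuantumLattice Literature.Probability.LatticeModels
open Literature.MathematicalPhysics.QuantumLattice.FermiRG
open Summit.HubbardSuperconductivity.HubbardSuperconductivity.Theorems.KLRegimeSplit
open Summit.HubbardSuperconductivity.HubbardSuperconductivity.Theorems.KLProgrammeLegKernels
open Summit.HubbardSuperconductivity.HubbardSuperconductivity.Theorems.DispersionFlow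

variable {L M : ℕ} [NeZero L]

/-- The tower's three-part decomposition of the scale-`j` action in the carriers of …EngineTowerModelDefs:
`𝒱_j = 𝒱_0 + Σ_{k<j/d} Δ_k + (𝒱_j − 𝒱_{d(j/d)})`. -/
theorem klEffectiveAction_eq_uv_add_incr_add_partial (β U μ : ℝ) (K : TrigPolyC4v) (d j : ℕ) :
    klEffectiveAction L M β U μ K klE0 j = klEffectiveAction L M β U μ K klE0 0 +
      ∑ k ∈ range (j / d), klTowerIncr L M β U μ K d k + (klEffectiveAction L M β U μ K klE0 j - klTowerInput L M β U μ K d (j / d)) :=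
  klEffectiveAction_eq_blocked β U μ K klE0 d j

/-- **Pointwise, weighted**: every level-`j` weighted pinned sum of `𝒱_j` is at most the three-part sum of the corresponding pinned sums. -/
theorem klWtPinnedSum_le_three_parts {β : ℝ} (hβ : 0 ≤ β) (U μ : ℝ) (K : TrigPolyC4v) (d j m : ℕ) (q : Fin m)
    (w : SpaceTimeIdx L M × SectorLeg (sectorCount j)) :
    klWtPinnedSum L M β U μ K j m q w ≤
      klWtPinnedSumOf L M β μ K j m (klEffectiveAction L M β U μ K klE0 0) q w +
        ∑ k ∈ range (j / d), klWtPinnedSumOf L M β μ K j m (klTowerIncr L M β U μ K d k) q w +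
          klWtPinnedSumOf L M β μ K j m (klEffectiveAction L M β U μ K klE0 j - klTowerInput L M β U μ K d (j / d)) q w := by
  rw [← klWtPinnedSumOf_klEffectiveAction]
  conv_lhs => rw [klEffectiveAction_eq_uv_add_incr_add_partial β U μ K d j]
  refine (klWtPinnedSumOf_add_le hβ μ K j m _ _ q w).trans (add_le_add ?_ le_rfl)
  exact (klWtPinnedSumOf_add_le hβ μ K j m _ _ q w).trans (add_le_add le_rfl (klWtPinnedSumOf_sum_le hβ μ K j m _ _ q w))

/-- **Pointwise, levelled**: every level-`j` levelled norm of `𝒱_j` is at most the three-part sum of the corresponding levelled norms. -/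
theorem klAnisoLegKernelNormAt_le_three_parts {β : ℝ} (hβ : 0 ≤ β) (U μ : ℝ) (K : TrigPolyC4v) (d j m : ℕ)
    (Ωe : Fin m → Option (SectorLeg (sectorCount j))) :
    klAnisoLegKernelNormAt L M β U μ K klE0 j m Ωe ≤
      klLevNormOf L M β μ K j m (klEffectiveAction L M β U μ K klE0 0) Ωe +
        ∑ k ∈ range (j / d), klLevNormOf L M β μ K j m (klTowerIncr L M β U μ K d k) Ωe +
          klLevNormOf L M β μ K j m (klEffectiveAction L M β U μ K klE0 j - klTowerInput L M β U μ K d (j / d)) Ωe := by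
  rw [← klLevNormOf_klEffectiveAction]
  conv_lhs => rw [klEffectiveAction_eq_uv_add_incr_add_partial β U μ K d j]
  refine (klLevNormOf_add_le hβ μ K j m _ _ Ωe).trans (add_le_add ?_ le_rfl)
  exact (klLevNormOf_add_le hβ μ K j m _ _ Ωe).trans (add_le_add le_rfl (klLevNormOf_sum_le hβ μ K j m _ _ Ωe))

/-- **`KernelNormsWt4` at level `j` from the tower's three-part suprema** fitted under the E1 budget in every degree `m ≠ 2`. -/
theorem kernelNormsWt4_klWtBudget_of_towerSups {β : ℝ} (hβ : 0 ≤ β) {U μ : ℝ} {K : TrigPolyC4v} {d j : ℕ} {P : SplitConsts} {Q : EngConsts}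
    (hfit : ∀ m : ℕ, m ≠ 2 →
      (⨆ qw : Fin m × (SpaceTimeIdx L M × SectorLeg (sectorCount j)),
          klWtPinnedSumOf L M β μ K j m (klEffectiveAction L M β U μ K klE0 0) qw.1 qw.2) +
        ∑ k ∈ range (j / d), (⨆ qw : Fin m × (SpaceTimeIdx L M × SectorLeg (sectorCount j)),
          klWtPinnedSumOf L M β μ K j m (klTowerIncr L M β U μ K d k) qw.1 qw.2) +
        (⨆ qw : Fin m × (SpaceTimeIdx L M × SectorLeg (sectorCount j)),
          klWtPinnedSumOf L M β μ K j m (klEffectiveAction L M β U μ K klE0 j - klTowerInput L M β U μ K d (j / d)) qw.1 qw.2) ≤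
        klWtBudget P Q U j m) :
    KernelNormsWt4 L M (klWtBudget P Q U j) β U μ K j := by
  intro m hm q w
  refine (klWtPinnedSum_le_three_parts hβ U μ K d j m q w).trans (le_trans ?_ (hfit m hm))
  have hsup : ∀ T : HubbardGrassmann L M, klWtPinnedSumOf L M β μ K j m T q w ≤
      ⨆ qw : Fin m × (SpaceTimeIdx L M × SectorLeg (sectorCount j)), klWtPinnedSumOf L M β μ K j m T qw.1 qw.2 := fun T =>
    le_ciSup (f := fun qw : Fin m × (SpaceTimeIdx L M × SectorLeg (sectorCount j)) => klWtPinnedSumOf L M β μ K j m T qw.1 qw.2)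
      (Set.finite_range _).bddAbove (q, w)
  exact add_le_add (add_le_add (hsup _) (sum_le_sum fun k _ => hsup _)) (hsup _)

/-- **`KernelNormsLevels` at level `j` from the tower's three-part suprema over prescriptions** fitted under the levels law for every `p ≥ 3` and level-count `F`. -/
theorem kernelNormsLevels_of_towerSups {β : ℝ} (hβ : 0 ≤ β) {U μ : ℝ} {K : TrigPolyC4v} {d j : ℕ} {P : SplitConsts} {Q : EngConsts}
    (hfit : ∀ p : ℕ, 3 ≤ p → ∀ F : ℕ,
      (⨆ Ωe : {Ωe : Fin (2 * p) → Option (SectorLeg (sectorCount j)) // levelCount Ωe = F},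
          klLevNormOf L M β μ K j (2 * p) (klEffectiveAction L M β U μ K klE0 0) Ωe.1) +
        ∑ k ∈ range (j / d), (⨆ Ωe : {Ωe : Fin (2 * p) → Option (SectorLeg (sectorCount j)) // levelCount Ωe = F},
          klLevNormOf L M β μ K j (2 * p) (klTowerIncr L M β U μ K d k) Ωe.1) +
        (⨆ Ωe : {Ωe : Fin (2 * p) → Option (SectorLeg (sectorCount j)) // levelCount Ωe = F},
          klLevNormOf L M β μ K j (2 * p) (klEffectiveAction L M β U μ K klE0 j - klTowerInput L M β U μ K d (j / d)) Ωe.1) ≤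
        Q.CE ^ p * (epsCoupling P U j) ^ (p - 1) * (2 : ℝ) ^ ((3 * (p : ℤ) - 5) * j) * (((2 : ℝ) ^ j)⁻¹) ^ levelGainExp F) :
    KernelNormsLevels L M P Q β U μ K j := by
  intro p hp Ωe
  refine (klAnisoLegKernelNormAt_le_three_parts hβ U μ K d j (2 * p) Ωe).trans (le_trans ?_ (hfit p hp (levelCount Ωe)))
  have hsup : ∀ T : HubbardGrassmann L M, klLevNormOf L M β μ K j (2 * p) T Ωe ≤
      ⨆ Ωe' : {Ωe' : Fin (2 * p) → Option (SectorLeg (sectorCount j)) // levelCount Ωe' = levelCount Ωe},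
        klLevNormOf L M β μ K j (2 * p) T Ωe'.1 := fun T =>
    le_ciSup (f := fun Ωe' : {Ωe' : Fin (2 * p) → Option (SectorLeg (sectorCount j)) // levelCount Ωe' = levelCount Ωe} =>
      klLevNormOf L M β μ K j (2 * p) T Ωe'.1) (Set.finite_range _).bddAbove ⟨Ωe, rfl⟩
  exact add_le_add (add_le_add (hsup _) (sum_le_sum fun k _ => hsup _)) (hsup _)

end Summit.HubbardSuperconductivity.HubbardSuperconductivity.Theorems.EngineV8

end
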